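import Mathlib
import Summits.NavierStokesRegularity.NavierStokesRegularity.Theorems.EulerZoomLiouvillePowerGaugeEulerLiouvilleSelfSimilarFiniteNodalSetExclusion
import HarnessLib.Audit

/-!
# Rung C1 of the crux `EulerZoomLiouville.PowerGaugeEulerLiouville`: the nodal-COUNTABILITY exclusion —
# a nontrivial in-window self-similar Euler profile has UNCOUNTABLY many stagnation points

Route №10 `EulerZoomLiouville` (NavierStokesRegularity), crux E = stmt-NavierStokesRegularity-19832,
tenure rung C1 (exactly self-similar members), registered residue `stub_selfSimilarExtremal`.
Eighth file of the NODAL-FINITENESS chain (lineage ns-typeII-p2, gen 6): the same mechanism with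
FINITE replaced by COUNTABLE.  Finiteness entered the chain at exactly two points — convergence of every
backward trajectory to a single node, and countability of the Baire cover — and both survive for a
countable nodal set:

* `tendsto_of_transport_comp_tendsto_zero_of_countable` — a bounded curve along which `V → 0`
  converges to each of its cluster points `z` when the zero set of `V` is COUNTABLE: for every `ε`
  there is a radius `r ∈ (0, ε)` whose sphere about `z` contains NO zero of `V` (the distances from `z`
  to the zeros form a countable set, whose complement is dense, Mathlib `Set.Countable.dense_compl`);
  on that sphere (intersected with the confining ball) `‖V‖` has a positive minimum, so the curve
  cannot cross it at late times (intermediate value theorem).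
* `exists_tendsto_backward_orbit_of_countable` — hence, with the far field (3.8) and `γ ≠ ½`, every
  backward self-similar trajectory converges to a node.
* `curl_eq_zero_of_countable_nodalSet_of_certificates` — the Baire assembly of
  `…SelfSimilarFiniteNodalSet` verbatim with a countable index set.
* `eq_zero_of_countable_nodalSet` — **MAIN THEOREM: `0 < γ < ½`, `C²` profile with (3.8), COUNTABLE
  nodal set ⇒ `U ≡ 0`** (every node is certified, `certificate_of_mem_nodalSet`);
  `not_countable_selfSimilarNodalSet_of_ne_zero`: **a nontrivial classical in-window profile has
  UNCOUNTABLY many stagnation points** (its compact nodal set cannot consist of isolated points plus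
  countably many accumulation points; it contains a perfect set).

WHAT THIS IS NOT: not NS, not E, not rung C1 — classical (`C²`) profiles with the far field (3.8);
uncountable nodal sets (stagnation curves and surfaces) and the weak class are untouched.

## References

* P. Constantin, M. Ignatova, V. Vicol, arXiv:2602.17570 (2026), §3.5 Def 3.7, Thms 3.8–3.10, §4
  (stagnation circles of axisymmetric profiles). [ConstantinIgnatovaVicol2026Putative]
-/

noncomputable section

-- flat `Theorems/<Route><Decl>…` files of one crux share the namespace of the crux (tree convention)
set_option linter.dupNamespace false

open Set Filter Topology Metric Function InnerProductSpace
open scoped RealInnerProductSpace NNReal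

namespace Summit.NavierStokesRegularity.NavierStokesRegularity.Theorems.PowerGaugeEulerLiouville.NodalFiniteness

open Literature.Analysis Literature.Analysis.FluidPDE Literature.Analysis.ODE

variable {γ C : ℝ} {c : EuclideanSpace ℝ (Fin 3)}
  {U : EuclideanSpace ℝ (Fin 3) → EuclideanSpace ℝ (Fin 3)} {P : EuclideanSpace ℝ (Fin 3) → ℝ}

/-! ### Convergence to a cluster point when the zero set is countable -/

/-- A countable set of reals misses some point of every nondegenerate open interval (its complement is
dense, Mathlib `Set.Countable.dense_compl`). [folklore] -/
private theorem exists_mem_Ioo_not_mem_of_countable {S : Set ℝ} (hS : S.Countable) {a b : ℝ}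
    (hab : a < b) : ∃ r ∈ Ioo a b, r ∉ S := by
  obtain ⟨r, hrS, hr⟩ := (hS.dense_compl ℝ).exists_mem_open isOpen_Ioo (nonempty_Ioo.2 hab)
  exact ⟨r, hr, hrS⟩

/-- **A bounded curve along which `V → 0` converges to its cluster point, if the zero set of `V` is
COUNTABLE.**  Let `V` be continuous with countably many zeros, `Y` a continuous curve with `‖Y(t)‖ ≤ B`
for `t ≥ 0` and `V(Y(t)) → 0`, and `z` a cluster point of `Y`.  Then `Y(t) → z`: for `ε > 0` choose
`r ∈ (0, ε)` with no zero of `V` at distance exactly `r` from `z`; on the compact set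
`{‖y‖ ≤ B, dist(y,z) = r}` the continuous `‖V‖` is positive, hence `≥ m₀ > 0`; after the time from
which `‖V(Y)‖ < m₀` the curve never crosses that sphere, and it visits `B(z, r)`, so it stays there.
[folklore] -/
theorem tendsto_of_transport_comp_tendsto_zero_of_countable
    {V : EuclideanSpace ℝ (Fin 3) → EuclideanSpace ℝ (Fin 3)} (hVc : Continuous V)
    (hN : {y | V y = 0}.Countable) {Y : ℝ → EuclideanSpace ℝ (Fin 3)} (hYc : Continuous Y)
    {B : ℝ} (hB : ∀ t, 0 ≤ t → ‖Y t‖ ≤ B)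
    (hV0 : Tendsto (fun t => V (Y t)) atTop (𝓝 0))
    {z : EuclideanSpace ℝ (Fin 3)} (hcl : MapClusterPt z atTop Y) :
    Tendsto Y atTop (𝓝 z) := by
  rw [Metric.tendsto_atTop]
  intro ε hε
  -- a radius `r ∈ (0, ε)` avoided by the zeros of `V`
  have hR : ((fun y => dist y z) '' {y | V y = 0}).Countable := hN.image _
  obtain ⟨r, ⟨hr0, hrε⟩, hrS⟩ := exists_mem_Ioo_not_mem_of_countable hR hε
  -- the compact sphere piece `K`
  set K : Set (EuclideanSpace ℝ (Fin 3)) := closedBall 0 B ∩ {y | dist y z = r} with hK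
  have hKc : IsCompact K :=
    (isCompact_closedBall 0 B).inter_right (isClosed_eq (continuous_id.dist continuous_const)
      continuous_const)
  have hVpos : ∀ y ∈ K, 0 < ‖V y‖ := by
    rintro y ⟨_, hy⟩
    rw [norm_pos_iff]
    intro hVy
    exact hrS ⟨y, hVy, hy⟩
  obtain ⟨m₀, hm₀, hKle⟩ := hKc.exists_forall_le' hVc.norm.continuousOn hVpos
  have hev : ∀ᶠ t in atTop, ‖V (Y t)‖ < m₀ :=
    (tendsto_zero_iff_norm_tendsto_zero.1 hV0).eventually (Iio_mem_nhds hm₀)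
  obtain ⟨T, hT⟩ := (hev.and (eventually_ge_atTop 0)).exists_forall_of_atTop
  have hfreq : ∃ᶠ t in atTop, Y t ∈ ball z r := hcl.frequently (ball_mem_nhds z hr0)
  obtain ⟨t₁, ht₁, ht₁T⟩ := (hfreq.and_eventually (eventually_ge_atTop T)).exists
  refine ⟨t₁, fun t ht => ?_⟩
  have htT : T ≤ t := ht₁T.trans ht
  -- if `dist (Y t) z ≥ r`, the curve crosses the sphere at some `s ∈ [t₁, t]`
  by_contra hge
  push Not at hge
  have hge' : r ≤ dist (Y t) z := hrε.le.trans hge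
  have hcont : ContinuousOn (fun s => dist (Y s) z) (Icc t₁ t) :=
    (hYc.dist continuous_const).continuousOn
  have hmem : r ∈ Icc (dist (Y t₁) z) (dist (Y t) z) := ⟨(mem_ball.1 ht₁).le, hge'⟩
  obtain ⟨s, hs, hsr⟩ := intermediate_value_Icc ht hcont hmem
  have hsT : T ≤ s := ht₁T.trans hs.1
  have hs0 : 0 ≤ s := (hT s hsT).2
  have hYsK : Y s ∈ K := ⟨mem_closedBall_zero_iff.2 (hB s hs0), by simpa using hsr⟩
  have h1 := hKle (Y s) hYsK
  have h2 := (hT s hsT).1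
  linarith

/-- **Backward trajectories converge to stagnation points** when the nodal set is COUNTABLE
(`γ > 0`, `γ ≠ ½`, far field (3.8)): bounded (`backward_orbit_bounded`), accumulating at a node
(Barbalat, tree `exists_mem_nodalSet_mapClusterPt_of_bounded`), and converging to it
(`tendsto_of_transport_comp_tendsto_zero_of_countable`).
[cite: ConstantinIgnatovaVicol2026Putative, §3.4.3 eq. (3.33), §3.5 proof of Thm 3.10] -/
theorem exists_tendsto_backward_orbit_of_countable (h : IsSelfSimilarEulerProfile γ c U P) (hγ : 0 < γ)
    (hγ' : γ ≠ 1 / 2) (hfar : HasSelfSimilarFarFieldWith γ c C U)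
    (hN : (selfSimilarNodalSet γ c U).Countable) {K : ℝ≥0}
    (hK : LipschitzWith K (selfSimilarTransport γ c U)) (x : EuclideanSpace ℝ (Fin 3)) :
    ∃ z ∈ selfSimilarNodalSet γ c U, Tendsto (fun t => lipschitzFlow hK x (-t)) atTop (𝓝 z) := by
  have hY := hasDerivAt_backwardFlow hK x
  obtain ⟨B, hB⟩ := backward_orbit_bounded hγ hfar hY
  obtain ⟨z, hzN, _, hcl⟩ :=
    h.exists_mem_nodalSet_mapClusterPt_of_bounded hγ' (by norm_num : (-1 : ℝ) ≠ 0) hY hB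
  have hV0 := h.tendsto_transport_comp_of_bounded hγ' (by norm_num : (-1 : ℝ) ≠ 0) hY hB
  have hVc : Continuous (selfSimilarTransport γ c U) := by
    have e : selfSimilarTransport γ c U = fun y => γ • (y - c) + U y := rfl
    rw [e]
    exact ((continuous_id.sub continuous_const).const_smul γ).add h.contDiff_velocity.continuous
  have hN' : {y | selfSimilarTransport γ c U y = 0}.Countable := by
    have e : {y | selfSimilarTransport γ c U y = 0} = selfSimilarNodalSet γ c U := by
      ext y; rw [mem_setOf_eq, mem_selfSimilarNodalSet_iff, selfSimilarTransport_apply]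
    rw [e]; exact hN
  have hYc : Continuous fun t => lipschitzFlow hK x (-t) :=
    continuous_iff_continuousAt.2 fun t => (hY t).continuousAt
  exact ⟨z, hzN, tendsto_of_transport_comp_tendsto_zero_of_countable hVc hN' hYc hB hV0 hcl⟩

/-! ### The Baire assembly with a countable nodal set -/

/-- **Vorticity form, COUNTABLE nodal set.**  Let `0 < γ < ½`, `(U, P)` a `C²` self-similar Euler
profile with (3.8) whose nodal set is countable, every node carrying a KILL or a THIN certificate.
Then `curl U = 0` (Baire: `{Ω = 0}` and the countably many closed, interior-free sets
`{x : Φ_{−t}x ∈ B̄(z, δ_z) ∀ t ≥ n}` at THIN nodes cover `ℝ³`).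
[cite: ConstantinIgnatovaVicol2026Putative, §3.5 Thm 3.10 (countable nodal set; outgoing inequality and analyticity removed)] -/
theorem curl_eq_zero_of_countable_nodalSet_of_certificates (h : IsSelfSimilarEulerProfile γ c U P)
    (hγ : 0 < γ) (hγ2 : γ < 1 / 2) (hfar : HasSelfSimilarFarFieldWith γ c C U)
    (hN : (selfSimilarNodalSet γ c U).Countable)
    (hcert : ∀ z ∈ selfSimilarNodalSet γ c U,
      (∃ (B : EuclideanSpace ℝ (Fin 3) →L[ℝ] EuclideanSpace ℝ (Fin 3) →L[ℝ] ℝ) (cB β' : ℝ),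
        0 < cB ∧ β' < 1 + γ ∧ (∀ v, cB * ‖v‖ ^ 2 ≤ B v v) ∧
        ∀ v, B (fderiv ℝ (selfSimilarTransport γ c U) z v) v +
          B v (fderiv ℝ (selfSimilarTransport γ c U) z v) ≤ 2 * β' * B v v) ∨
      (∃ (Q : EuclideanSpace ℝ (Fin 3) →L[ℝ] EuclideanSpace ℝ (Fin 3) →L[ℝ] ℝ) (η θ : ℝ)
        (e : EuclideanSpace ℝ (Fin 3)), 0 < η ∧ θ ≤ 0 ∧ 0 < Q e e ∧
        ∀ v, Q (fderiv ℝ (selfSimilarTransport γ c U) z v) v +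
          Q v (fderiv ℝ (selfSimilarTransport γ c U) z v) ≤ 2 * θ * Q v v - η * ‖v‖ ^ 2)) :
    curl U = 0 := by
  classical
  set V := selfSimilarTransport γ c U with hV
  set N := selfSimilarNodalSet γ c U with hNdef
  have hγ' : γ ≠ 1 / 2 := hγ2.ne
  have hK := lipschitzWith_transport h hγ hfar
  set Kill : EuclideanSpace ℝ (Fin 3) → Prop := fun z =>
    ∃ (B : EuclideanSpace ℝ (Fin 3) →L[ℝ] EuclideanSpace ℝ (Fin 3) →L[ℝ] ℝ) (cB β' : ℝ),
      0 < cB ∧ β' < 1 + γ ∧ (∀ v, cB * ‖v‖ ^ 2 ≤ B v v) ∧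
      ∀ v, B (fderiv ℝ V z v) v + B v (fderiv ℝ V z v) ≤ 2 * β' * B v v with hKill
  have hthin : ∀ z, z ∈ N → ¬ Kill z → ∃ δ : ℝ, 0 < δ ∧
      interior {x : EuclideanSpace ℝ (Fin 3) |
        ∀ t, 0 ≤ t → lipschitzFlow hK x (-t) ∈ closedBall z δ} = ∅ := by
    intro z hz hk
    rcases hcert z hz with hk' | ⟨Q, η, θ, e, hη, hθ, he, hc⟩
    · exact absurd hk' hk
    · obtain ⟨δ, hδ, hint⟩ := interior_backwardTrapped_eq_empty h hK z Q hη hθ hc he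
      exact ⟨δ, hδ, hint⟩
  choose! δ hδpos hδint using hthin
  haveI : Countable N := hN.to_subtype
  set Z : Set (EuclideanSpace ℝ (Fin 3)) := {x | curl U x = 0} with hZ
  set S : Option (N × ℕ) → Set (EuclideanSpace ℝ (Fin 3)) := fun i =>
    i.elim Z fun p => if Kill (p.1 : EuclideanSpace ℝ (Fin 3)) then ∅ else
      {x | ∀ t, (p.2 : ℝ) ≤ t → lipschitzFlow hK x (-t) ∈ closedBall (p.1 : EuclideanSpace ℝ (Fin 3))
        (δ p.1)} with hS
  have hcurlc : Continuous (curl U) := h.isSelfSimilarEulerVorticityProfile.differentiable_curl.continuous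
  have hZc : IsClosed Z := isClosed_eq hcurlc continuous_const
  have hSc : ∀ i, IsClosed (S i) := by
    rintro (_ | ⟨z, n⟩)
    · exact hZc
    · simp only [hS, Option.elim]
      split_ifs
      · exact isClosed_empty
      · exact isClosed_backwardTrapped h hK _ _ _
  have hSint : ∀ p : N × ℕ, interior (S (some p)) = ∅ := by
    rintro ⟨z, n⟩
    simp only [hS, Option.elim]
    split_ifs with hk
    · exact interior_empty
    · exact interior_backwardTrapped_from_eq_empty h hK _ _ (hδint z z.2 hk) _
  have hcover : ⋃ i, S i = univ := by
    rw [eq_univ_iff_forall]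
    intro x
    rw [mem_iUnion]
    by_cases hx : curl U x = 0
    · exact ⟨none, hx⟩
    obtain ⟨z, hzN, hz⟩ := exists_tendsto_backward_orbit_of_countable h hγ hγ' hfar hN hK x
    by_cases hk : Kill z
    · obtain ⟨B, cB, β', hcB, hβ', hB, hc⟩ := hk
      have h0 := curl_comp_eq_zero_of_tendsto_of_lowerCertificate h
        (norm_curl_le_of_farField hγ hfar) (norm_fderiv_le_of_farField hγ hfar)
        (hasDerivAt_backwardFlow hK x) hz B hcB hB hβ' hc
      simp only [neg_zero, lipschitzFlow_zero] at h0
      exact absurd h0 hx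
    · have hδz := hδpos z hzN hk
      have hev : ∀ᶠ t in atTop, dist (lipschitzFlow hK x (-t)) z < δ z :=
        Metric.tendsto_nhds.1 hz _ hδz
      obtain ⟨T₀, hT₀⟩ := hev.exists_forall_of_atTop
      obtain ⟨n, hn⟩ := exists_nat_ge T₀
      refine ⟨some (⟨z, hzN⟩, n), ?_⟩
      simp only [hS, Option.elim, if_neg hk]
      intro t ht
      exact mem_closedBall.2 (hT₀ t (hn.trans ht)).le
  have hdense := dense_iUnion_interior_of_closed hSc hcover
  have hsub : (⋃ i, interior (S i)) ⊆ interior Z := by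
    intro x hx
    rw [mem_iUnion] at hx
    obtain ⟨i, hi⟩ := hx
    rcases i with _ | p
    · exact hi
    · rw [hSint p] at hi; exact hi.elim
  have hZd : Dense (interior Z) := hdense.mono hsub
  have hZuniv : Z = univ := by
    apply eq_univ_of_univ_subset
    rw [← hZd.closure_eq]
    exact (closure_mono interior_subset).trans hZc.closure_subset
  funext x
  have : x ∈ Z := hZuniv ▸ mem_univ x
  exact this

/-! ### The unconditional countable version -/

/-- **NODAL-COUNTABILITY EXCLUSION (unconditional).**  Let `0 < γ < ½` and let `(U, P)` be a `C²`
self-similar Euler profile (CIV (3.3)) with the far-field bounds (3.8).  If the transport field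
`V = γ(y−c) + U` has only COUNTABLY MANY stagnation points, then `U ≡ 0`.  (Every node is certified,
`certificate_of_mem_nodalSet`; vorticity vanishes by `curl_eq_zero_of_countable_nodalSet_of_certificates`;
then the harmonic Liouville step.)
[cite: ConstantinIgnatovaVicol2026Putative, §3.5 Thm 3.10 (countable nodal set; outgoing inequality and analyticity removed)] -/
theorem eq_zero_of_countable_nodalSet (h : IsSelfSimilarEulerProfile γ c U P) (hγ : 0 < γ)
    (hγ2 : γ < 1 / 2) (hfar : HasSelfSimilarFarFieldWith γ c C U)
    (hN : (selfSimilarNodalSet γ c U).Countable) : U = 0 := by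
  have hcurl0 := curl_eq_zero_of_countable_nodalSet_of_certificates h hγ hγ2 hfar hN
    fun _ hz => certificate_of_mem_nodalSet h hγ hγ2 hz
  have hcurl : ∀ x, curl U x = 0 := fun x => congrFun hcurl0 x
  have hD := hfar.tendsto_norm_fderiv hγ
  funext y
  rw [eq_of_curl_eq_zero_of_isDivFree_of_fderiv_tendsto_zero h.contDiff_velocity hcurl h.divFree hD
    y c, hfar.apply_center]
  rfl

/-- **A nontrivial classical in-window profile has UNCOUNTABLY MANY stagnation points.**
[cite: ConstantinIgnatovaVicol2026Putative, §3.5 Thm 3.10 (countable nodal set; outgoing inequality and analyticity removed)] -/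
theorem not_countable_selfSimilarNodalSet_of_ne_zero (h : IsSelfSimilarEulerProfile γ c U P)
    (hγ : 0 < γ) (hγ2 : γ < 1 / 2) (hfar : HasSelfSimilarFarFieldWith γ c C U) (hU : U ≠ 0) :
    ¬ (selfSimilarNodalSet γ c U).Countable :=
  fun hN => hU (eq_zero_of_countable_nodalSet h hγ hγ2 hfar hN)

/-- **Exponent form** (route EulerZoomLiouville: `γ = 1/(2+ρ)`, window `ρ > 0`).
[cite: ConstantinIgnatovaVicol2026Putative, §3.5 Thm 3.10 (countable nodal set; outgoing inequality and analyticity removed)] -/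
theorem eq_zero_of_countable_nodalSet_of_exponent {ρ : ℝ} (hρ : 0 < ρ)
    (h : IsSelfSimilarEulerProfile (1 / (2 + ρ)) c U P)
    (hfar : HasSelfSimilarFarFieldWith (1 / (2 + ρ)) c C U)
    (hN : (selfSimilarNodalSet (1 / (2 + ρ)) c U).Countable) : U = 0 := by
  have hγ : 0 < 1 / (2 + ρ) := by positivity
  have hγ2 : 1 / (2 + ρ) < 1 / 2 := by
    rw [div_lt_div_iff₀ (by positivity) (by positivity)]; linarith
  exact eq_zero_of_countable_nodalSet h hγ hγ2 hfar hN

end Summit.NavierStokesRegularity.NavierStokesRegularity.Theorems.PowerGaugeEulerLiouville.NodalFiniteness
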